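import Summits.Ventures.HSemireg.WedgeHankelSubstitutionMoments

/-!
# Venture HSemireg — THE GENERAL LINEAR SUBSTITUTION (2d): EIGENVECTORS ON THE CLASSES — the pure class of a node goes to `(α+λγ)^m` times the pure class of its Möbius image,
# so pure classes at FIXED nodes are eigenvectors; upper substitutions (`γ = 0`) fix `∞` and its point class; the diagonal torus is diagonal in th-7's basis `E_p` with the weights
# `a^{m−p} d^p`; the stabilizer of TWO nodes is the torus `β = −λ₁λ₂γ`, `δ = α + (λ₁+λ₂)γ` with eigenvalues `α + λ_iγ`

HONEST FRAMING. Part of the Lean index of the computation cell `pub-hsemireg` (seat p10 gen 19, Sunday typer «UNIFORM-IN-n»).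
Finite-dimensional EXTERIOR ALGEBRA over a field + th-7's sequence vocabulary ONLY: no variety, no cohomology theory, no sheaf, no Ext group, no semiregularity map;
nothing here says that HC / HC_CM / HC_AV holds; no Literature fact is declared or used.  Custodian versions as in `WedgeHankelSiegelIdeal` (1/3) and `WedgeHankelFrameChange`;
the dictionary (the pure class `w_m(λ^•)` = `exp(λΘ)`, the point class `w_m(δ_m) = E_m` = the node at `∞`; a substitution acts on the frame letter `x + λy` by
`(α + λγ)·(x + λ′y)`, `λ′ = (β + λδ)/(α + λγ)`) is QUOTED, never asserted.

WHAT IS IN THE TREE.  H1 (899) `Sb`, `sbSeq`, `Sb_w`, `sbSeq_smul`; H2 (915) the Möbius theorem on node KERNELS and the class formula `Sb_w_expMul_eq_w_expMul` for general local data;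
H5 (926) `Kr_Sb_w_expMul_eq_iff` (a node kernel is fixed iff the node is a Möbius fixed point); H11 (935) three fixed node kernels ⇒ homothety (`mobius_fixed_three`), `sbSeq_scalar`.
THIS FILE reads the substitution on the PURE and POINT classes themselves and names the stabilizer of two nodes (namespace `Summit.Ventures.HSemireg.Wedge.HankelFrameChange` continued):
* §170 **`sbSeq_pure`: `sbSeq α β γ δ m (λ^•) j = (α+λγ)^{m−j} (β+λδ)^j`** (`j ≤ m`; the moments of the evaluation at the point `(1, λ)`), hence **`Sb_w_pure`** and, for `α + λγ ≠ 0`,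
  **`Sb_w_pure_of_ne`: `Sb α β γ δ (w_m(λ^•)) = (α+λγ)^m · w_m(λ′^•)`**, `λ′ = (β+λδ)/(α+λγ)` — THE PURE CLASS OF A NODE GOES TO A SCALAR TIMES THE PURE CLASS OF ITS MÖBIUS IMAGE; for
  `α + λγ = 0` it goes to `(β+λδ)^m` times the POINT class `w_m(δ_m)` (`Sb_w_pure_of_eq`: the node is sent to `∞`).
* §171 FIXED NODES ARE EIGENVECTORS: **`Sb_w_pure_of_fixed`: `β + λδ = λ(α+λγ) ⇒ Sb α β γ δ (w_m(λ^•)) = (α+λγ)^m · w_m(λ^•)`** (no non-degeneracy hypothesis); UPPER substitutions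
  (`γ = 0`, i.e. `∞` fixed): `sbSeq_upper_eq_zero` / **`sbSeq_upper_apply_self`** (co-supports `[P, m]` are kept, the bottom coefficient is multiplied by `α^{m−P}δ^P` — the mirror of H2 §129),
  **`Sb_w_point_of_upper`: `Sb α β 0 δ (w_m(δ_m)) = δ^m · w_m(δ_m)`** (the point class is an eigenvector).
* §172 THE DIAGONAL TORUS OF `GL₂`: `sbSeq_diag` (`sbSeq a 0 0 d m q j = a^{m−j} d^j q_j`), `Sb_diag_w`, **`Sb_diag_w_spike`: `Sb a 0 0 d (E_p) = a^{m−p} d^p · E_p`** — th-7's monomial classes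
  `E_p = w_m(δ_p)` ARE the weight vectors, with the weights of `Sym^m` (dictionary quoted).
* §173 TWO FIXED NODES: **`mobius_fixed_two_iff`** (`λ₁ ≠ λ₂`: both fixed iff `δ = α + (λ₁+λ₂)γ ∧ β = −λ₁λ₂γ` — a TORUS through the homotheties), `det_of_fixed_two`
  (`αδ − βγ = (α+λ₁γ)(α+λ₂γ)`), **`Kr_Sb_fixes_two_iff`** (H5 ×2: a substitution fixes the kernels of two node classes at distinct nodes iff it lies in that torus) and
  **`Sb_w_pure_of_fixed_two`** (then the two pure classes are eigenvectors with eigenvalues `(α+λ₁γ)^m`, `(α+λ₂γ)^m`).  H11's «three fixed ⇒ homothety» is the intersection of two such tori.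
NOT typed here: the full eigenspace decomposition of `Sb g` on the class space `coSiegel_n` for a diagonalizable `g` (it is `Sym^n`: weights `(α+λ₁γ)^{n−p}(α+λ₂γ)^p` on the classes
`w_n` of the frame `{x+λ₁y, x+λ₂y}` — needs G3's frame bases); Jordan type for a parabolic `g` (one fixed node); anything Ext-side.  Class side only; new names only.
-/

open Module

namespace Summit.Ventures.HSemireg.Wedge.HankelFrameChange

open Summit.Ventures.HSemireg.Wedge Summit.Ventures.HSemireg.Wedge.Kunneth Summit.Ventures.HSemireg.Wedge.Hankel
  Summit.Ventures.HSemireg.Wedge.BasisFree Summit.Ventures.HSemireg.Wedge.HankelSiegel Summit.Ventures.HSemireg.Wedge.HankelSiegelIdeal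
  Summit.Ventures.HSemireg.Wedge.KunnethKernel Summit.Ventures.HSemireg.Wedge.HankelRankOne

variable (K : Type*) [Field K] {n : ℕ}

/-! ## §170. The moments of a pure sequence and the image of a pure class -/

/-- shifting a pure sequence multiplies it by `λ`. -/
lemma shift_pure (lam : K) : shift K (fun j => lam ^ j) = fun j => lam * lam ^ j := by
  funext j; rw [shift_apply, pow_succ, mul_comm]

/-- **THE MOMENTS OF A PURE SEQUENCE: `sbSeq α β γ δ m (λ^•) j = (α + λγ)^{m−j} (β + λδ)^j`** for `j ≤ m` (dictionary: the functional «evaluate at `(1, λ)`» has moments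
`(α·1 + γλ)^{m−j}(β·1 + δλ)^j` after the substitution). -/
theorem sbSeq_pure (α β γ δ lam : K) : ∀ (m : ℕ) {j : ℕ}, j ≤ m → sbSeq K α β γ δ m (fun i => lam ^ i) j = (α + lam * γ) ^ (m - j) * (β + lam * δ) ^ j
  | 0, 0, _ => by rw [sbSeq_zero_zero, pow_zero, Nat.sub_zero, pow_zero, pow_zero, mul_one]
  | m + 1, 0, _ => by
    rw [sbSeq_succ_zero, shift_pure, sbSeq_smul, sbSeq_pure α β γ δ lam m (Nat.zero_le m), Nat.sub_zero, Nat.sub_zero, pow_zero, mul_one, mul_one, pow_succ]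
    ring
  | m + 1, j + 1, h => by
    rw [sbSeq_succ_succ, shift_pure, sbSeq_smul, sbSeq_pure α β γ δ lam m (show j ≤ m by omega), Nat.succ_sub_succ, pow_succ (β + lam * δ)]
    ring

/-- **`Sb α β γ δ (w_m(λ^•)) = w_m(((α+λγ)^{m−j}(β+λδ)^j)_j)`** (`m ≤ n`, EVERY `α β γ δ λ`). -/
theorem Sb_w_pure (α β γ δ lam : K) {m : ℕ} (hm : m ≤ n) :
    Sb K α β γ δ (w K n m (fun j => lam ^ j)) = w K n m (fun j => (α + lam * γ) ^ (m - j) * (β + lam * δ) ^ j) := by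
  rw [Sb_w K α β γ δ hm]
  exact w_eq_of_agree K m fun j hj => sbSeq_pure K α β γ δ lam m hj

/-- **THE PURE CLASS OF A NODE GOES TO `(α+λγ)^m` TIMES THE PURE CLASS OF ITS MÖBIUS IMAGE: `Sb α β γ δ (w_m(λ^•)) = (α+λγ)^m · w_m(λ′^•)`, `λ′ = (β+λδ)/(α+λγ)`** (`α + λγ ≠ 0`, `m ≤ n`). -/
theorem Sb_w_pure_of_ne {α γ lam : K} (ha : α + lam * γ ≠ 0) (β δ : K) {m : ℕ} (hm : m ≤ n) :
    Sb K α β γ δ (w K n m (fun j => lam ^ j)) = (α + lam * γ) ^ m • w K n m (fun j => ((β + lam * δ) / (α + lam * γ)) ^ j) := by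
  rw [Sb_w_pure K α β γ δ lam hm, ← w_smul]
  refine w_eq_of_agree K m fun j hj => ?_
  rw [div_pow, mul_div_assoc', eq_div_iff (pow_ne_zero _ ha), mul_assoc, mul_comm ((β + lam * δ) ^ j), ← mul_assoc, ← pow_add, Nat.sub_add_cancel hj]

/-- **`α + λγ = 0`: THE NODE GOES TO `∞` — `Sb α β γ δ (w_m(λ^•)) = (β+λδ)^m · w_m(δ_m)`** (the point class; `m ≤ n`). -/
theorem Sb_w_pure_of_eq {α γ lam : K} (ha : α + lam * γ = 0) (β δ : K) {m : ℕ} (hm : m ≤ n) :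
    Sb K α β γ δ (w K n m (fun j => lam ^ j)) = (β + lam * δ) ^ m • w K n m (fun j => if j = m then (1 : K) else 0) := by
  rw [Sb_w_pure K α β γ δ lam hm, ← w_smul]
  refine w_eq_of_agree K m fun j hj => ?_
  rw [ha]
  by_cases h : j = m
  · rw [if_pos h, h, Nat.sub_self, pow_zero, one_mul, mul_one]
  · rw [if_neg h, mul_zero, zero_pow (by omega), zero_mul]

/-! ## §171. Fixed nodes are eigenvectors -/

/-- **A FIXED NODE GIVES AN EIGENVECTOR: `β + λδ = λ(α + λγ) ⇒ Sb α β γ δ (w_m(λ^•)) = (α+λγ)^m · w_m(λ^•)`** (`m ≤ n`; no non-degeneracy hypothesis). -/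
theorem Sb_w_pure_of_fixed {α β γ δ lam : K} (h : β + lam * δ = lam * (α + lam * γ)) {m : ℕ} (hm : m ≤ n) :
    Sb K α β γ δ (w K n m (fun j => lam ^ j)) = (α + lam * γ) ^ m • w K n m (fun j => lam ^ j) := by
  rw [Sb_w_pure K α β γ δ lam hm, ← w_smul]
  refine w_eq_of_agree K m fun j hj => ?_
  rw [h, mul_pow, ← mul_assoc, mul_comm ((α + lam * γ) ^ (m - j)), mul_assoc (lam ^ j), ← pow_add, Nat.sub_add_cancel hj, mul_comm]

/-- an UPPER substitution (`γ = 0`) reads `q_0, …, q_j` only from `q_j` upward: if `q` vanishes below `P`, so does `sbSeq α β 0 δ m q` (the mirror of H2's `sbSeq_lower_eq_zero`). -/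
theorem sbSeq_upper_eq_zero (α β δ : K) : ∀ (m : ℕ) (q : ℕ → K) {P j : ℕ}, (∀ i, i < P → q i = 0) → j < P → sbSeq K α β 0 δ m q j = 0
  | 0, q, P, 0, hq, hj => by rw [sbSeq_zero_zero]; exact hq 0 hj
  | 0, _, _, _ + 1, _, _ => rfl
  | m + 1, q, P, 0, hq, hj => by rw [sbSeq_succ_zero, zero_mul, add_zero, sbSeq_upper_eq_zero α β δ m q hq hj, mul_zero]
  | m + 1, q, P, j + 1, hq, hj => by
    have hq' : ∀ i, i < P - 1 → shift K q i = 0 := fun i hi => hq (i + 1) (by omega)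
    rw [sbSeq_succ_succ, sbSeq_upper_eq_zero α β δ m q hq (by omega), sbSeq_upper_eq_zero α β δ m (shift K q) hq' (by omega), mul_zero, mul_zero, add_zero]

/-- **… and the bottom coefficient is multiplied by `α^{m−P} δ^P`: `sbSeq α β 0 δ m q P = α^{m−P} δ^P q_P`** (`q` vanishing below `P`, `P ≤ m`). -/
theorem sbSeq_upper_apply_self (α β δ : K) : ∀ (m : ℕ) (q : ℕ → K) {P : ℕ}, (∀ i, i < P → q i = 0) → P ≤ m → sbSeq K α β 0 δ m q P = α ^ (m - P) * δ ^ P * q P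
  | 0, q, 0, _, _ => by rw [sbSeq_zero_zero, pow_zero, pow_zero, one_mul, one_mul]
  | m + 1, q, 0, hq, _ => by
    rw [sbSeq_succ_zero, zero_mul, add_zero, sbSeq_upper_apply_self α β δ m q hq (Nat.zero_le m), Nat.sub_zero, Nat.sub_zero, pow_zero, mul_one, mul_one, pow_succ]
    ring
  | m + 1, q, P + 1, hq, hP => by
    have hq' : ∀ i, i < P → shift K q i = 0 := fun i hi => hq (i + 1) (by omega)
    rw [sbSeq_succ_succ, sbSeq_upper_eq_zero K α β δ m q hq (Nat.lt_succ_self P), mul_zero, zero_add, sbSeq_upper_apply_self α β δ m (shift K q) hq' (by omega),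
      shift_apply, Nat.succ_sub_succ, pow_succ]
    ring

/-- **`∞` FIXED: THE POINT CLASS IS AN EIGENVECTOR OF EVERY UPPER SUBSTITUTION — `Sb α β 0 δ (w_m(δ_m)) = δ^m · w_m(δ_m)`** (`m ≤ n`). -/
theorem Sb_w_point_of_upper (α β δ : K) {m : ℕ} (hm : m ≤ n) :
    Sb K α β 0 δ (w K n m (fun j => if j = m then (1 : K) else 0)) = δ ^ m • w K n m (fun j => if j = m then (1 : K) else 0) := by
  rw [Sb_w K α β 0 δ hm, ← w_smul]
  refine w_eq_of_agree K m fun j hj => ?_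
  have hq : ∀ i, i < m → (fun j => if j = m then (1 : K) else 0) i = 0 := fun i hi => if_neg (by omega)
  rcases lt_or_eq_of_le hj with h | h
  · rw [sbSeq_upper_eq_zero K α β δ m _ hq h, if_neg (by omega), mul_zero]
  · rw [h, sbSeq_upper_apply_self K α β δ m _ hq le_rfl, if_pos rfl, Nat.sub_self, pow_zero, one_mul]

/-! ## §172. The diagonal torus is diagonal in th-7's basis -/

/-- the moment transform of a DIAGONAL substitution `x ↦ ax`, `y ↦ dy`: `sbSeq a 0 0 d m q j = a^{m−j} d^j q_j` (`j ≤ m`; E12's `sbSeq_scale` and F5's `sbSeq_xscale` are `a = 1` / `d = 1`). -/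
theorem sbSeq_diag (a d : K) : ∀ (m : ℕ) (q : ℕ → K) {j : ℕ}, j ≤ m → sbSeq K a 0 0 d m q j = a ^ (m - j) * d ^ j * q j
  | 0, q, 0, _ => by rw [sbSeq_zero_zero, pow_zero, pow_zero, one_mul, one_mul]
  | m + 1, q, 0, _ => by rw [sbSeq_succ_zero, zero_mul, add_zero, sbSeq_diag a d m q (Nat.zero_le _), Nat.sub_zero, Nat.sub_zero, pow_zero, pow_succ]; ring
  | m + 1, q, j + 1, h => by rw [sbSeq_succ_succ, zero_mul, zero_add, sbSeq_diag a d m (shift K q) (by omega), shift_apply, Nat.succ_sub_succ, pow_succ]; ring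

/-- **`Sb a 0 0 d (w_m q) = w_m((a^{m−j} d^j q_j)_j)`** (`m ≤ n`). -/
theorem Sb_diag_w (a d : K) {m : ℕ} (hm : m ≤ n) (q : ℕ → K) : Sb K a 0 0 d (w K n m q) = w K n m (fun j => a ^ (m - j) * d ^ j * q j) := by
  rw [Sb_w K a 0 0 d hm]
  exact w_eq_of_agree K m fun j hj => sbSeq_diag K a d m q hj

/-- **TH-7's MONOMIAL CLASSES ARE THE WEIGHT VECTORS OF THE DIAGONAL TORUS: `Sb a 0 0 d (E_p) = a^{m−p} d^p · E_p`**, `E_p = w_m(δ_p)`, `m ≤ n` (for `p > m` both sides vanish; the weights of `Sym^m`, dictionary quoted). -/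
theorem Sb_diag_w_spike (a d : K) {m : ℕ} (p : ℕ) (hm : m ≤ n) :
    Sb K a 0 0 d (w K n m (fun j => if j = p then (1 : K) else 0)) = (a ^ (m - p) * d ^ p) • w K n m (fun j => if j = p then (1 : K) else 0) := by
  rw [Sb_diag_w K a d hm, ← w_smul]
  refine w_eq_of_agree K m fun j _ => ?_
  by_cases h : j = p
  · rw [if_pos h, h, mul_one]
  · rw [if_neg h, mul_zero, mul_zero]

/-! ## §173. Two fixed nodes: the stabilizer torus -/

omit [Field K] in
/-- **TWO DISTINCT FIXED POINTS: `β + λ_iδ = λ_i(α + λ_iγ)` for `λ₁ ≠ λ₂` IFF `δ = α + (λ₁+λ₂)γ` AND `β = −λ₁λ₂γ`** — the stabilizer of two nodes is a torus (`α`, `γ` free) through the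
homotheties (`γ = 0`). -/
theorem mobius_fixed_two_iff {F : Type*} [Field F] {α β γ δ l₁ l₂ : F} (h₁₂ : l₁ ≠ l₂) :
    (β + l₁ * δ = l₁ * (α + l₁ * γ) ∧ β + l₂ * δ = l₂ * (α + l₂ * γ)) ↔ (δ = α + (l₁ + l₂) * γ ∧ β = -(l₁ * l₂ * γ)) := by
  constructor
  · rintro ⟨e₁, e₂⟩
    have d : δ = α + (l₁ + l₂) * γ := by
      have h : (l₁ - l₂) * δ = (l₁ - l₂) * (α + (l₁ + l₂) * γ) := by linear_combination e₁ - e₂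
      exact mul_left_cancel₀ (sub_ne_zero.mpr h₁₂) h
    exact ⟨d, by linear_combination e₁ - l₁ * d⟩
  · rintro ⟨d, b⟩
    constructor
    · rw [d, b]; ring
    · rw [d, b]; ring

omit [Field K] in
/-- on that torus the determinant factors through the two eigenvalues: `αδ − βγ = (α + λ₁γ)(α + λ₂γ)`. -/
theorem det_of_fixed_two {F : Type*} [Field F] {α β γ δ l₁ l₂ : F} (d : δ = α + (l₁ + l₂) * γ) (b : β = -(l₁ * l₂ * γ)) :
    α * δ - β * γ = (α + l₁ * γ) * (α + l₂ * γ) := by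
  rw [d, b]; ring

/-- **THE STABILIZER OF TWO NODE KERNELS IS THE TORUS**: for node classes of exact orders `P_i < k` (`k + P_i ≤ n`) at DISTINCT nodes `λ₁ ≠ λ₂` (`α + λ_iγ ≠ 0`, `αδ − βγ ≠ 0`), the substitution
fixes BOTH degree-`k` kernels iff `δ = α + (λ₁+λ₂)γ` and `β = −λ₁λ₂γ` (H5 `Kr_Sb_w_expMul_eq_iff` twice + §173). -/
theorem Kr_Sb_fixes_two_iff {α β γ δ l₁ l₂ : K} (h₁₂ : l₁ ≠ l₂) (ha₁ : α + l₁ * γ ≠ 0) (ha₂ : α + l₂ * γ ≠ 0) (hdet : α * δ - β * γ ≠ 0) {k P₁ P₂ : ℕ}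
    (hP₁k : P₁ < k) (hkP₁ : k + P₁ ≤ n) (hP₂k : P₂ < k) (hkP₂ : k + P₂ ≤ n) {q₁ q₂ : ℕ → K} (hq₁ : ∀ j, P₁ < j → q₁ j = 0) (hq₁P : q₁ P₁ ≠ 0)
    (hq₂ : ∀ j, P₂ < j → q₂ j = 0) (hq₂P : q₂ P₂ ≠ 0) :
    (Kr K Finset.univ (Sb K α β γ δ (w K n n (expMul K l₁ q₁))) k = Kr K Finset.univ (w K n n (expMul K l₁ q₁)) k ∧
      Kr K Finset.univ (Sb K α β γ δ (w K n n (expMul K l₂ q₂))) k = Kr K Finset.univ (w K n n (expMul K l₂ q₂)) k) ↔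
    (δ = α + (l₁ + l₂) * γ ∧ β = -(l₁ * l₂ * γ)) := by
  rw [Kr_Sb_w_expMul_eq_iff K ha₁ hdet hP₁k hkP₁ hq₁ hq₁P, Kr_Sb_w_expMul_eq_iff K ha₂ hdet hP₂k hkP₂ hq₂ hq₂P]
  exact mobius_fixed_two_iff h₁₂

/-- **… and then the two PURE classes are EIGENVECTORS with eigenvalues `(α + λ₁γ)^m`, `(α + λ₂γ)^m`** (`m ≤ n`). -/
theorem Sb_w_pure_of_fixed_two {α β γ δ l₁ l₂ : K} (d : δ = α + (l₁ + l₂) * γ) (b : β = -(l₁ * l₂ * γ)) {m : ℕ} (hm : m ≤ n) :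
    Sb K α β γ δ (w K n m (fun j => l₁ ^ j)) = (α + l₁ * γ) ^ m • w K n m (fun j => l₁ ^ j) ∧
      Sb K α β γ δ (w K n m (fun j => l₂ ^ j)) = (α + l₂ * γ) ^ m • w K n m (fun j => l₂ ^ j) :=
  ⟨Sb_w_pure_of_fixed K (by rw [d, b]; ring) hm, Sb_w_pure_of_fixed K (by rw [d, b]; ring) hm⟩

/-- the homotheties (`γ = 0`, `β = 0`, `δ = α`) lie on every such torus — H11's «three fixed nodes ⇒ homothety» is the intersection of the tori of two of the pairs. -/
theorem mobius_fixed_two_of_scalar {F : Type*} [Field F] (α l₁ l₂ : F) : (α : F) = α + (l₁ + l₂) * 0 ∧ (0 : F) = -(l₁ * l₂ * 0) := by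
  constructor <;> ring

end Summit.Ventures.HSemireg.Wedge.HankelFrameChange
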